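import Mathlib
import Summits.Ventures.PercRepro2.StepZeroOfAS3

/-!
# Pattern-level Reimer rows, and STEP(i,i+2) is BAL(i+1,i+1)  (seat mine-b, cell pub-perc-repro2)

For the two-colour pattern `(O, Y)` of a finite multigraph (`StepZeroOfAS3.lean`: `stepH` = `H(i,j)`,
`stepT` = `T(a,b)`), this file records

* `stepT_zero_add_le`: **`T(0, a+b) ≤ T(a, b)`** for all `a, b` — Reimer's inequality on the pattern
  for the pair `({F ≥ a}, {F ≥ b})`: `a + b` edge-disjoint blue paths give disjoint witnesses of the
  two flow events inside the blue `Y`-set (`kDisj_add_dOcc`, `dOcc_pin_of_dOcc_union`), and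
  `reimer_increasing` (mine-1) bounds their number by `#{F_B ≥ a, F_R ≥ b} = T(b,a) = T(a,b)`.  The
  case `a = 1` is the pattern-level form of the `a = 1` rows of the BAL family (`IteratedBK.lean`
  has them at the probability level);
* `stepH_step_iff_bal`: **STEP(i, i+2) ⟺ BAL(i+1, i+1)** on every pattern: `H(i,i+2) ≤ H(i+1,i+1)`
  iff `T(i,i+2) ≤ T(i+1,i+1)` (MINE-B.md §11.1 (R1)); in particular the strand inequality STEP(1,3)
  of ASSIGNMENTS v12.05 is the pattern-level BAL(2,2) `T(1,3) ≤ T(2,2)`, the first open member of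
  row B2;
* `stepT_slack_split`: the Reimer slack `T(1,2) − T(0,3)` is the sum of the STEP(0,3) slack
  `H(1,2) − H(0,3)` and the BAL(2,2) slack `T(2,2) − T(1,3)` (an identity in `ℕ`).
-/

open Finset

namespace Summit.Ventures.PercRepro2

namespace StepZero

open ReimerCube

variable {V : Type*} {E : Type*} [DecidableEq E]

/-- `a + b` disjoint witnesses of `A` split into `a` and `b` disjoint witnesses: `kDisj A (a+b) S`
gives disjoint `K, L ⊆ S` with `kDisj A a` on every superset of `K` and `kDisj A b` on every
superset of `L`. -/
lemma kDisj_add_dOcc (A : Finset E → Prop) :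
    ∀ (a b : ℕ) {S : Finset E}, kDisj A (a + b) S → DOcc (kDisj A a) (kDisj A b) S
  | 0, b, S, h => by
      rw [Nat.zero_add] at h
      exact ⟨∅, S, Finset.empty_subset _, le_rfl, Finset.disjoint_empty_left _,
        fun _ _ => trivial, fun T hT => incr_kDisj A b hT h⟩
  | a + 1, b, S, h => by
      have e : a + 1 + b = a + b + 1 := by omega
      rw [e] at h
      obtain ⟨K₁, L₁, hK₁, hL₁, hd, hA, hB⟩ := h
      obtain ⟨K', L', hK', hL', hd', hKa, hLb⟩ := kDisj_add_dOcc A a b (hB L₁ le_rfl)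
      refine ⟨K₁ ∪ K', L', Finset.union_subset hK₁ (hK'.trans hL₁), hL'.trans hL₁, ?_, ?_, hLb⟩
      · exact Finset.disjoint_union_left.2
          ⟨Finset.disjoint_of_subset_right hL' hd, hd'⟩
      · intro T hT
        exact ⟨K₁, K', Finset.subset_union_left.trans hT, Finset.subset_union_right.trans hT,
          Finset.disjoint_of_subset_right hK' hd, hA, hKa⟩

/-- Trimming the pins: a disjoint occurrence of the flow events inside `O ∪ γ` is a disjoint
occurrence of the pinned flow events inside `γ`. -/
lemma dOcc_pin_of_dOcc_union (ends : E → Sym2 V) (s t : V) (O : Finset E) (a b : ℕ) {γ : Finset E}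
    (h : DOcc (kDisj (fun T => Carries ends T s t) a) (kDisj (fun T => Carries ends T s t) b) (O ∪ γ)) :
    DOcc (pinFlow ends s t O a) (pinFlow ends s t O b) γ := by
  obtain ⟨K, L, hK, hL, hKL, hA, hB⟩ := h
  refine ⟨K \ O, L \ O, ?_, ?_, ?_, ?_, ?_⟩
  · intro x hx
    rcases Finset.mem_union.mp (hK (Finset.mem_sdiff.mp hx).1) with h1 | h1
    · exact absurd h1 (Finset.mem_sdiff.mp hx).2
    · exact h1
  · intro x hx
    rcases Finset.mem_union.mp (hL (Finset.mem_sdiff.mp hx).1) with h1 | h1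
    · exact absurd h1 (Finset.mem_sdiff.mp hx).2
    · exact h1
  · exact Finset.disjoint_of_subset_left Finset.sdiff_subset
      (Finset.disjoint_of_subset_right Finset.sdiff_subset hKL)
  · intro T hT
    apply hA
    intro x hx
    by_cases hxO : x ∈ O
    · exact Finset.mem_union_left _ hxO
    · exact Finset.mem_union_right _ (hT (Finset.mem_sdiff.mpr ⟨hx, hxO⟩))
  · intro T hT
    apply hB
    intro x hx
    by_cases hxO : x ∈ O
    · exact Finset.mem_union_left _ hxO
    · exact Finset.mem_union_right _ (hT (Finset.mem_sdiff.mpr ⟨hx, hxO⟩))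

open Classical in
/-- **Reimer on the pattern for every split: `T(0, a+b) ≤ T(a, b)`** (`a = 1`: the pattern-level
`a = 1` rows of the BAL family, `T(0, b+1) ≤ T(1, b)`). -/
theorem stepT_zero_add_le (ends : E → Sym2 V) (s t : V) (O Y : Finset E) (a b : ℕ) :
    stepT ends s t O Y 0 (a + b) ≤ stepT ends s t O Y a b := by
  rw [stepT_swap ends s t O Y a b]
  unfold stepT
  have h := reimer_increasing Y (pinFlow ends s t O a) (pinFlow ends s t O b)
    (incr_pinFlow ends s t O a) (incr_pinFlow ends s t O b)
  refine le_trans (Finset.card_le_card ?_) (le_trans h (Finset.card_le_card ?_))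
  · intro γ hγ
    rw [Finset.mem_filter] at hγ ⊢
    exact ⟨hγ.1, dOcc_pin_of_dOcc_union ends s t O a b (kDisj_add_dOcc _ a b hγ.2.2)⟩
  · intro γ hγ
    rw [Finset.mem_filter] at hγ ⊢
    exact ⟨hγ.1, hγ.2.2, hγ.2.1⟩

/-- **STEP(i, i+2) ⟺ BAL(i+1, i+1)** on every pattern: the diagonal STEP inequality is the
diagonal balance `T(i, i+2) ≤ T(i+1, i+1)` (MINE-B.md §11.1 (R1)); for `i = 1` the strand
inequality STEP(1,3) is the pattern-level BAL(2,2). -/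
theorem stepH_step_iff_bal (ends : E → Sym2 V) (s t : V) (O Y : Finset E) (i : ℕ) :
    stepH ends s t O Y i (i + 2) ≤ stepH ends s t O Y (i + 1) (i + 1)
      ↔ stepT ends s t O Y i (i + 2) ≤ stepT ends s t O Y (i + 1) (i + 1) := by
  have h1 : stepT ends s t O Y i (i + 2)
      = stepT ends s t O Y (i + 1) (i + 2) + stepH ends s t O Y i (i + 2) :=
    stepT_eq_add_stepH ends s t O Y i (i + 2)
  have h2 : stepT ends s t O Y (i + 1) (i + 1)
      = stepT ends s t O Y (i + 2) (i + 1) + stepH ends s t O Y (i + 1) (i + 1) :=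
    stepT_eq_add_stepH ends s t O Y (i + 1) (i + 1)
  have h3 := stepT_swap ends s t O Y (i + 2) (i + 1)
  constructor <;> intro h <;> omega

/-- The Reimer slack at `(0,3)` splits into the STEP(0,3) slack and the BAL(2,2) slack:
`T(1,2) + H(0,3) + T(1,3) = T(0,3) + H(1,2) + T(2,2)`, i.e.
`T(1,2) − T(0,3) = (H(1,2) − H(0,3)) + (T(2,2) − T(1,3))`. -/
theorem stepT_slack_split (ends : E → Sym2 V) (s t : V) (O Y : Finset E) :
    stepT ends s t O Y 1 2 + stepH ends s t O Y 0 3 + stepT ends s t O Y 1 3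
      = stepT ends s t O Y 0 3 + stepH ends s t O Y 1 2 + stepT ends s t O Y 2 2 := by
  have h1 : stepT ends s t O Y 0 3 = stepT ends s t O Y 1 3 + stepH ends s t O Y 0 3 :=
    stepT_eq_add_stepH ends s t O Y 0 3
  have h2 : stepT ends s t O Y 1 2 = stepT ends s t O Y 2 2 + stepH ends s t O Y 1 2 :=
    stepT_eq_add_stepH ends s t O Y 1 2
  omega

end StepZero

end Summit.Ventures.PercRepro2
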